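import Summits.QuantumFields.BalabanUV.Beta.D1BFx.Assembly

/-!
# `BalabanUV.Beta.D1BFx.AssemblyDefect` — road «BF-x» for binder row D1, re-cut slot (K), row (K7) «TRANSFER-Δ» (part 4, the A7 socket for (K6c)):
# THE ASSEMBLY OF `D1BFx.Assembly` WHEN SLOT (F) CARRIES A DEFECT PER PIECE — `secondMoment (P i n) = Σ_b wt·fullSum (Kf i n b) + D i n` —
# the defects enter the road's defect identity as ONE extra term `Σ_i ω i n · D i n`, and drop out when that weighted sum vanishes (the (K7)
# cancellation `MomentTransferDefectTotal.sum_rowDefect_eq_zero_of_divFree` from the TOTAL's Ward row); conclusions IDENTICAL to the record's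

HONEST DEPENDENCY (page 1, mandatory): continuum YM on T⁴ ⇐ BetaPertH ∧ nine spine estimates (0/9 proved); BetaPertH ⇐ (D1) ∧ (D4) ∧
CAP+tail; G-an2-4 gates asym, D1 and NE2/3/4.  HONEST FRAMING (cell contract, verbatim): «discharging `BetaPertH` makes Bałaban's UV
stability UNCONDITIONAL — a real constructive-QFT result; it is NOT the continuum limit and NOT the Clay problem.»  [folklore] `ring` ∕ triangle
bookkeeping composed BY NAME from A7 (`Assembly.fullSum_weighted_combination` and the proof pattern of `Assembly.defect_eq_of_slots` ∕
`abs_defect_le_of_slots` ∕ `hT_of_slots` ∕ `hT_mean_of_slots`, whose (F) slot has NO defect term and therefore cannot be instantiated by the re-cut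
END's pieces); no `def`, no `Prop` fact, nothing of the manuscripts under audit asserted or cited; 0∕4 row-D1 binders; slot (K) NOT closed; nothing of
D1 ∕ BetaPertH discharged.  Value = the assembly socket of the re-cut END `AssemblyEndRouteT.defect_le_at_total_routeT` (owner spec
`HOME/b2b-balaban-beta-d1-p2/K-END-RECUT-SPEC.md` §5 (K6c) ∕ (K7), ruling ρ-g7-9): its (F) rows are `MomentTransferDefect.secondMoment_TOfLeg_eq_avg_fullSum_add_rowDefect`
(defect `D i n = rowDefect n (fineHessA …) μ ν`) and its `hD` is `sum_rowDefect_eq_zero_of_divFree` fed by `hWardTot`; NOT summit progress; NOT continuum, NOT Clay.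

CONTENT (all [folklore] theorems; slots exactly as `Assembly` §4 with (F) ↦ (F+Δ) and the new slot (Δ) `∀ n ≥ 2, Σ_i ω i n · D i n = 0`):
* `defect_eq_of_slots_add` — the defect identity WITH the extra term `+ Σ_i ω i n · D i n` (no (Δ) assumed);
* `defect_eq_of_slots_cancel` — under (Δ): the record's identity verbatim;
* `abs_defect_le_of_slots_cancel`, `hT_of_slots_cancel` (strong grading), `hT_mean_of_slots_cancel` (mean grading) — the record's bounds verbatim.
-/

open Finset Filter Topology
open scoped BigOperators
open Literature.MathematicalPhysics.QuantumFieldTheory.Balaban1983to89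
open Literature.MathematicalPhysics.QuantumFieldTheory.Balaban1983to89.Beta
open WindowIdentification (fullSum psum)
open DyadicShell (Pt)
open SquareTable (stK)
open Summit.QuantumFields.BalabanUV.Beta.D1BFx.Assembly (fullSum_weighted_combination)

namespace Summit.QuantumFields.BalabanUV.Beta.D1BFx.AssemblyDefect

section Assembly

variable {κB ι υ T : Type*} [Fintype ι] [Fintype υ] [Fintype T] {μ ν : Fin 4} {N : ℝ}
  {c : ℕ → ℝ} {Bset : ℕ → Finset κB} {wt : ℕ → κB → ℝ} {Gf : ℕ → κB → Pt → ℝ}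
  {P : ι → ℕ → B12Beta.Kernel 4} {ω : ι → ℕ → ℝ} {R : υ → ℕ → ℝ} {Kf : ι → ℕ → κB → Pt → ℝ} {Kr : T → ℕ → κB → Pt → ℝ}
  {D : ι → ℕ → ℝ}

/-- [folklore] **THE DEFECT IDENTITY WITH PER-PIECE TRANSFER DEFECTS.**  Under the slots (K) kernel representation, (F+Δ) fine representation of every
fine-loop piece UP TO AN EXPLICIT DEFECT `D i n`, (CONV) convergence of every fine integrand, and (SPLIT) the pointwise term list with the MAIN term
isolated, the road's defect `c n − Σ_b wt n b · fullSum (stK μ ν N (Gf n b))` IS the unit pieces plus the base-point-averaged full sums of the REST tables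
PLUS `Σ_i ω i n · D i n` — an identity, for every `n ≥ 2`. -/
theorem defect_eq_of_slots_add
    (hK : ∀ n : ℕ, 2 ≤ n → c n = (∑ i, ω i n * B12Beta.secondMoment (P i n) μ ν) + ∑ u, R u n)
    (hF : ∀ (i : ι) (n : ℕ), 2 ≤ n → B12Beta.secondMoment (P i n) μ ν = (∑ b ∈ Bset n, wt n b * fullSum (Kf i n b)) + D i n)
    (hKf : ∀ (i : ι) (n : ℕ), 2 ≤ n → ∀ b ∈ Bset n, ∃ B, Tendsto (psum (Kf i n b)) atTop (𝓝 B))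
    (hKr : ∀ (τ : T) (n : ℕ), 2 ≤ n → ∀ b ∈ Bset n, ∃ B, Tendsto (psum (Kr τ n b)) atTop (𝓝 B))
    (hsplit : ∀ n : ℕ, 2 ≤ n → ∀ b ∈ Bset n, ∀ w : Pt,
      (∑ i, ω i n * Kf i n b w) = stK μ ν N (Gf n b) w + ∑ τ, Kr τ n b w) :
    ∀ n : ℕ, 2 ≤ n →
      c n - ∑ b ∈ Bset n, wt n b * fullSum (stK μ ν N (Gf n b))
        = (∑ u, R u n) + (∑ τ, ∑ b ∈ Bset n, wt n b * fullSum (Kr τ n b)) + ∑ i, ω i n * D i n := by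
  intro n hn
  -- the MAIN full sum at base point `b` is the weighted fine pieces minus the REST pieces
  have hmain : ∀ b ∈ Bset n, fullSum (stK μ ν N (Gf n b))
      = (∑ i, ω i n * fullSum (Kf i n b)) - ∑ τ, fullSum (Kr τ n b) := by
    intro b hb
    have e : stK μ ν N (Gf n b) = fun w => (∑ i, ω i n * Kf i n b w) - ∑ τ, Kr τ n b w :=
      funext fun w => by rw [hsplit n hn b hb w]; ring
    rw [e]
    exact fullSum_weighted_combination univ univ (fun i => ω i n) (fun i _ => hKf i n hn b hb) (fun τ _ => hKr τ n hn b hb)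
  have hsum : ∑ b ∈ Bset n, wt n b * fullSum (stK μ ν N (Gf n b))
      = (∑ i, ω i n * ∑ b ∈ Bset n, wt n b * fullSum (Kf i n b)) - ∑ τ, ∑ b ∈ Bset n, wt n b * fullSum (Kr τ n b) := by
    calc ∑ b ∈ Bset n, wt n b * fullSum (stK μ ν N (Gf n b))
        = ∑ b ∈ Bset n, ((∑ i, wt n b * (ω i n * fullSum (Kf i n b))) - ∑ τ, wt n b * fullSum (Kr τ n b)) := by
          refine sum_congr rfl fun b hb => ?_
          rw [hmain b hb, mul_sub, mul_sum, mul_sum]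
      _ = (∑ b ∈ Bset n, ∑ i, wt n b * (ω i n * fullSum (Kf i n b))) - ∑ b ∈ Bset n, ∑ τ, wt n b * fullSum (Kr τ n b) :=
          sum_sub_distrib _ _
      _ = (∑ i, ∑ b ∈ Bset n, wt n b * (ω i n * fullSum (Kf i n b))) - ∑ τ, ∑ b ∈ Bset n, wt n b * fullSum (Kr τ n b) := by
          rw [sum_comm, sum_comm (s := Bset n)]
      _ = (∑ i, ω i n * ∑ b ∈ Bset n, wt n b * fullSum (Kf i n b)) - ∑ τ, ∑ b ∈ Bset n, wt n b * fullSum (Kr τ n b) := by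
          congr 1
          refine sum_congr rfl fun i _ => ?_
          rw [mul_sum]
          exact sum_congr rfl fun b _ => by ring
  have hKn : c n = (∑ i, ω i n * ∑ b ∈ Bset n, wt n b * fullSum (Kf i n b)) + (∑ i, ω i n * D i n) + ∑ u, R u n := by
    rw [hK n hn, ← sum_add_distrib]
    congr 1
    exact sum_congr rfl fun i _ => by rw [hF i n hn, mul_add]
  rw [hsum, hKn]
  ring

/-- [folklore] **THE DEFECT IDENTITY WHEN THE WEIGHTED DEFECTS CANCEL** — slot (Δ) `Σ_i ω i n · D i n = 0` (the (K7) cancellation from the TOTAL's Ward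
row): the record's `Assembly.defect_eq_of_slots` conclusion VERBATIM. -/
theorem defect_eq_of_slots_cancel
    (hK : ∀ n : ℕ, 2 ≤ n → c n = (∑ i, ω i n * B12Beta.secondMoment (P i n) μ ν) + ∑ u, R u n)
    (hF : ∀ (i : ι) (n : ℕ), 2 ≤ n → B12Beta.secondMoment (P i n) μ ν = (∑ b ∈ Bset n, wt n b * fullSum (Kf i n b)) + D i n)
    (hD : ∀ n : ℕ, 2 ≤ n → ∑ i, ω i n * D i n = 0)
    (hKf : ∀ (i : ι) (n : ℕ), 2 ≤ n → ∀ b ∈ Bset n, ∃ B, Tendsto (psum (Kf i n b)) atTop (𝓝 B))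
    (hKr : ∀ (τ : T) (n : ℕ), 2 ≤ n → ∀ b ∈ Bset n, ∃ B, Tendsto (psum (Kr τ n b)) atTop (𝓝 B))
    (hsplit : ∀ n : ℕ, 2 ≤ n → ∀ b ∈ Bset n, ∀ w : Pt,
      (∑ i, ω i n * Kf i n b w) = stK μ ν N (Gf n b) w + ∑ τ, Kr τ n b w) :
    ∀ n : ℕ, 2 ≤ n →
      c n - ∑ b ∈ Bset n, wt n b * fullSum (stK μ ν N (Gf n b))
        = (∑ u, R u n) + ∑ τ, ∑ b ∈ Bset n, wt n b * fullSum (Kr τ n b) := by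
  intro n hn
  rw [defect_eq_of_slots_add hK hF hKf hKr hsplit n hn, hD n hn, add_zero]

variable {CU : υ → ℝ} {CR : T → ℝ}

/-- [folklore] **THE STRONG BOUND FROM THE SLOTS WITH CANCELLING DEFECTS**: adding (U) `|R u n| ≤ CU u` and (REST) `|Σ_b wt n b · fullSum (Kr τ n b)| ≤ CR τ`,
the defect is bounded by `Σ_u CU u + Σ_τ CR τ`, uniformly in `n ≥ 2` — `Assembly.abs_defect_le_of_slots` VERBATIM for pieces with transfer defects. -/
theorem abs_defect_le_of_slots_cancel
    (hK : ∀ n : ℕ, 2 ≤ n → c n = (∑ i, ω i n * B12Beta.secondMoment (P i n) μ ν) + ∑ u, R u n)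
    (hF : ∀ (i : ι) (n : ℕ), 2 ≤ n → B12Beta.secondMoment (P i n) μ ν = (∑ b ∈ Bset n, wt n b * fullSum (Kf i n b)) + D i n)
    (hD : ∀ n : ℕ, 2 ≤ n → ∑ i, ω i n * D i n = 0)
    (hKf : ∀ (i : ι) (n : ℕ), 2 ≤ n → ∀ b ∈ Bset n, ∃ B, Tendsto (psum (Kf i n b)) atTop (𝓝 B))
    (hKr : ∀ (τ : T) (n : ℕ), 2 ≤ n → ∀ b ∈ Bset n, ∃ B, Tendsto (psum (Kr τ n b)) atTop (𝓝 B))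
    (hsplit : ∀ n : ℕ, 2 ≤ n → ∀ b ∈ Bset n, ∀ w : Pt,
      (∑ i, ω i n * Kf i n b w) = stK μ ν N (Gf n b) w + ∑ τ, Kr τ n b w)
    (hU : ∀ (u : υ) (n : ℕ), 2 ≤ n → |R u n| ≤ CU u)
    (hR : ∀ (τ : T) (n : ℕ), 2 ≤ n → |∑ b ∈ Bset n, wt n b * fullSum (Kr τ n b)| ≤ CR τ) :
    ∀ n : ℕ, 2 ≤ n → |c n - ∑ b ∈ Bset n, wt n b * fullSum (stK μ ν N (Gf n b))| ≤ (∑ u, CU u) + ∑ τ, CR τ := by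
  intro n hn
  rw [defect_eq_of_slots_cancel hK hF hD hKf hKr hsplit n hn]
  calc |(∑ u, R u n) + ∑ τ, ∑ b ∈ Bset n, wt n b * fullSum (Kr τ n b)|
      ≤ |∑ u, R u n| + |∑ τ, ∑ b ∈ Bset n, wt n b * fullSum (Kr τ n b)| := abs_add_le _ _
    _ ≤ (∑ u, |R u n|) + ∑ τ, |∑ b ∈ Bset n, wt n b * fullSum (Kr τ n b)| :=
        add_le_add (abs_sum_le_sum_abs _ _) (abs_sum_le_sum_abs _ _)
    _ ≤ (∑ u, CU u) + ∑ τ, CR τ := add_le_add (sum_le_sum fun u _ => hU u n hn) (sum_le_sum fun τ _ => hR τ n hn)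

/-- [folklore] **THE ROAD'S TARGET T (STRONG GRADING) FROM ITS SLOTS WITH CANCELLING DEFECTS** — EXACTLY the binder `hT` of
`RoadEnd.d1Drift_of_strongRoad` ∕ `ShellRoadEnd.d1Drift_of_strongRoad_shell` along `n = Lc^m`, `m ≥ 1`, with `U := Σ_u CU u + Σ_τ CR τ`. -/
theorem hT_of_slots_cancel {Lc : ℕ} (hLc : 2 ≤ Lc)
    (hK : ∀ n : ℕ, 2 ≤ n → c n = (∑ i, ω i n * B12Beta.secondMoment (P i n) μ ν) + ∑ u, R u n)
    (hF : ∀ (i : ι) (n : ℕ), 2 ≤ n → B12Beta.secondMoment (P i n) μ ν = (∑ b ∈ Bset n, wt n b * fullSum (Kf i n b)) + D i n)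
    (hD : ∀ n : ℕ, 2 ≤ n → ∑ i, ω i n * D i n = 0)
    (hKf : ∀ (i : ι) (n : ℕ), 2 ≤ n → ∀ b ∈ Bset n, ∃ B, Tendsto (psum (Kf i n b)) atTop (𝓝 B))
    (hKr : ∀ (τ : T) (n : ℕ), 2 ≤ n → ∀ b ∈ Bset n, ∃ B, Tendsto (psum (Kr τ n b)) atTop (𝓝 B))
    (hsplit : ∀ n : ℕ, 2 ≤ n → ∀ b ∈ Bset n, ∀ w : Pt,
      (∑ i, ω i n * Kf i n b w) = stK μ ν N (Gf n b) w + ∑ τ, Kr τ n b w)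
    (hU : ∀ (u : υ) (n : ℕ), 2 ≤ n → |R u n| ≤ CU u)
    (hR : ∀ (τ : T) (n : ℕ), 2 ≤ n → |∑ b ∈ Bset n, wt n b * fullSum (Kr τ n b)| ≤ CR τ) :
    ∀ m : ℕ, 1 ≤ m →
      |c (Lc ^ m) - ∑ b ∈ Bset (Lc ^ m), wt (Lc ^ m) b * fullSum (stK μ ν N (Gf (Lc ^ m) b))| ≤ (∑ u, CU u) + ∑ τ, CR τ :=
  fun _ hm => abs_defect_le_of_slots_cancel hK hF hD hKf hKr hsplit hU hR _
    (le_trans hLc (by simpa using Nat.pow_le_pow_right (le_trans one_le_two hLc) hm))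

/-- [folklore] **THE ROAD'S TARGET T_mean (MEAN GRADING) FROM ITS SLOTS WITH CANCELLING DEFECTS** — EXACTLY the binder `hT` of
`RoadEnd.d1Drift_of_meanRoad_table`: (U) and (REST) bounds growing like `g m` with `g m / m → 0` along `n = Lc^m`. -/
theorem hT_mean_of_slots_cancel {Lc : ℕ} (hLc : 2 ≤ Lc) {g : ℕ → ℝ} (hg : Tendsto (fun m : ℕ => g m / (m : ℝ)) atTop (𝓝 0))
    (hK : ∀ n : ℕ, 2 ≤ n → c n = (∑ i, ω i n * B12Beta.secondMoment (P i n) μ ν) + ∑ u, R u n)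
    (hF : ∀ (i : ι) (n : ℕ), 2 ≤ n → B12Beta.secondMoment (P i n) μ ν = (∑ b ∈ Bset n, wt n b * fullSum (Kf i n b)) + D i n)
    (hD : ∀ n : ℕ, 2 ≤ n → ∑ i, ω i n * D i n = 0)
    (hKf : ∀ (i : ι) (n : ℕ), 2 ≤ n → ∀ b ∈ Bset n, ∃ B, Tendsto (psum (Kf i n b)) atTop (𝓝 B))
    (hKr : ∀ (τ : T) (n : ℕ), 2 ≤ n → ∀ b ∈ Bset n, ∃ B, Tendsto (psum (Kr τ n b)) atTop (𝓝 B))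
    (hsplit : ∀ n : ℕ, 2 ≤ n → ∀ b ∈ Bset n, ∀ w : Pt,
      (∑ i, ω i n * Kf i n b w) = stK μ ν N (Gf n b) w + ∑ τ, Kr τ n b w)
    (hU : ∀ (u : υ) (m : ℕ), 1 ≤ m → |R u (Lc ^ m)| ≤ CU u * g m)
    (hR : ∀ (τ : T) (m : ℕ), 1 ≤ m → |∑ b ∈ Bset (Lc ^ m), wt (Lc ^ m) b * fullSum (Kr τ (Lc ^ m) b)| ≤ CR τ * g m) :
    Tendsto (fun m : ℕ => (c (Lc ^ m) - ∑ b ∈ Bset (Lc ^ m), wt (Lc ^ m) b * fullSum (stK μ ν N (Gf (Lc ^ m) b))) / (m : ℝ))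
      atTop (𝓝 0) := by
  set S : ℝ := (∑ u, CU u) + ∑ τ, CR τ with hS
  have hbd : ∀ m : ℕ, 1 ≤ m →
      |c (Lc ^ m) - ∑ b ∈ Bset (Lc ^ m), wt (Lc ^ m) b * fullSum (stK μ ν N (Gf (Lc ^ m) b))| ≤ S * g m := by
    intro m hm
    rw [defect_eq_of_slots_cancel hK hF hD hKf hKr hsplit _
      (le_trans hLc (by simpa using Nat.pow_le_pow_right (le_trans one_le_two hLc) hm))]
    calc |(∑ u, R u (Lc ^ m)) + ∑ τ, ∑ b ∈ Bset (Lc ^ m), wt (Lc ^ m) b * fullSum (Kr τ (Lc ^ m) b)|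
        ≤ (∑ u, |R u (Lc ^ m)|) + ∑ τ, |∑ b ∈ Bset (Lc ^ m), wt (Lc ^ m) b * fullSum (Kr τ (Lc ^ m) b)| :=
          (abs_add_le _ _).trans (add_le_add (abs_sum_le_sum_abs _ _) (abs_sum_le_sum_abs _ _))
      _ ≤ (∑ u, CU u * g m) + ∑ τ, CR τ * g m := add_le_add (sum_le_sum fun u _ => hU u m hm) (sum_le_sum fun τ _ => hR τ m hm)
      _ = S * g m := by rw [hS, ← sum_mul, ← sum_mul, add_mul]
  refine squeeze_zero_norm' (a := fun m => S * (g m / (m : ℝ))) ?_ ?_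
  · filter_upwards [eventually_ge_atTop 1] with m hm
    have hmpos : (0 : ℝ) < m := by exact_mod_cast hm
    rw [Real.norm_eq_abs, abs_div, abs_of_pos hmpos, ← mul_div_assoc]
    exact div_le_div_of_nonneg_right (hbd m hm) hmpos.le
  · have h := hg.const_mul S
    rw [mul_zero] at h
    exact h

end Assembly

end Summit.QuantumFields.BalabanUV.Beta.D1BFx.AssemblyDefect
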